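import Summits.Ventures.PercRepro.SMC

/-!
# Partitions of the marked indices: one-block, two-block partitions and block sets

Lattice facts about `Setoid (Fin k)` used by the C-006 labelling (`PairSumK.lean`): a partition
has at most one block iff it is `⊤` (`numBlocks_le_one_iff`); a partition above a two-block
partition is that partition or `⊤` (`eq_or_eq_top_of_le_of_numBlocks_eq_two`); the block of an
index (`block`), the set of blocks (`blockSet`) and its injectivity (`blockSet_injective`).
-/

namespace PercRepro

open Finset

/-! ### Partitions with at most one block, and two-block partitions -/

section Blocks

variable {k : ℕ}

open Classical in
/-- A partition has at most one block iff it is `⊤`. -/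
theorem numBlocks_le_one_iff (σ : Setoid (Fin k)) : numBlocks σ ≤ 1 ↔ σ = ⊤ := by
  unfold numBlocks
  constructor
  · intro h
    rw [Fintype.card_le_one_iff_subsingleton] at h
    refine Setoid.eq_top_iff.2 fun x y => ?_
    exact Quotient.exact (Subsingleton.elim (Quotient.mk σ x) (Quotient.mk σ y))
  · rintro rfl
    rw [Fintype.card_le_one_iff_subsingleton]
    exact ⟨fun a b => Quotient.inductionOn₂ a b fun x y => Quotient.sound trivial⟩

open Classical in
/-- In a two-block partition every index is related to `i` or to `j` as soon as `i`, `j` are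
unrelated. -/
theorem rel_or_rel_of_numBlocks_eq_two {σ : Setoid (Fin k)} (h2 : numBlocks σ = 2) {i j : Fin k}
    (hij : ¬ σ i j) (x : Fin k) : σ x i ∨ σ x j := by
  by_contra hx
  push Not at hx
  have hxi : Quotient.mk σ x ≠ Quotient.mk σ i := fun h => hx.1 (Quotient.exact h)
  have hxj : Quotient.mk σ x ≠ Quotient.mk σ j := fun h => hx.2 (Quotient.exact h)
  have hij' : Quotient.mk σ i ≠ Quotient.mk σ j := fun h => hij (Quotient.exact h)
  have h3 : ({Quotient.mk σ x, Quotient.mk σ i, Quotient.mk σ j} : Finset (Quotient σ)).card = 3 :=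
    Finset.card_eq_three.2 ⟨_, _, _, hxi, hxj, hij', rfl⟩
  have hle := Finset.card_le_univ ({Quotient.mk σ x, Quotient.mk σ i, Quotient.mk σ j} :
    Finset (Quotient σ))
  unfold numBlocks at h2
  rw [h3] at hle
  omega

open Classical in
/-- A partition above a two-block partition is that partition or `⊤`. -/
theorem eq_or_eq_top_of_le_of_numBlocks_eq_two {σ τ : Setoid (Fin k)} (h2 : numBlocks σ = 2)
    (hle : σ ≤ τ) : τ = σ ∨ τ = ⊤ := by
  by_cases hστ : τ = σ
  · exact Or.inl hστ
  right
  have hex : ∃ i j, τ i j ∧ ¬ σ i j := by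
    by_contra hcon
    push Not at hcon
    exact hστ (le_antisymm (Setoid.le_def.2 fun {x y} h => hcon x y h) hle)
  obtain ⟨i, j, hij, hnij⟩ := hex
  have hτ : ∀ a b, σ a b → τ a b := fun a b h => Setoid.le_def.1 hle h
  refine Setoid.eq_top_iff.2 fun x y => ?_
  rcases rel_or_rel_of_numBlocks_eq_two h2 hnij x with hx | hx <;>
    rcases rel_or_rel_of_numBlocks_eq_two h2 hnij y with hy | hy
  · exact τ.trans (hτ _ _ hx) (τ.symm (hτ _ _ hy))
  · exact τ.trans (hτ _ _ hx) (τ.trans hij (τ.symm (hτ _ _ hy)))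
  · exact τ.trans (hτ _ _ hx) (τ.trans (τ.symm hij) (τ.symm (hτ _ _ hy)))
  · exact τ.trans (hτ _ _ hx) (τ.symm (hτ _ _ hy))

open Classical in
/-- The block of `i` in `σ`. -/
noncomputable def block (σ : Setoid (Fin k)) (i : Fin k) : Finset (Fin k) :=
  univ.filter fun j => σ i j

open Classical in
/-- The set of blocks of `σ`. -/
noncomputable def blockSet (σ : Setoid (Fin k)) : Finset (Finset (Fin k)) := univ.image (block σ)

open Classical in
/-- Membership in the block of `i`. -/
theorem mem_block {σ : Setoid (Fin k)} {i j : Fin k} : j ∈ block σ i ↔ σ i j := by simp [block]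

open Classical in
/-- Two points have the same block iff they are related. -/
theorem block_eq_block_iff (σ : Setoid (Fin k)) (i j : Fin k) : block σ i = block σ j ↔ σ i j := by
  constructor
  · intro h
    have : j ∈ block σ i := h ▸ mem_block.2 (σ.refl j)
    exact mem_block.1 this
  · intro h
    ext x
    simp only [mem_block]
    exact ⟨fun hx => σ.trans (σ.symm h) hx, fun hx => σ.trans h hx⟩

open Classical in
/-- A partition is determined by its set of blocks. -/
theorem blockSet_injective : Function.Injective (blockSet : Setoid (Fin k) → Finset (Finset (Fin k))) := by
  intro σ τ h
  have key : ∀ i, block σ i = block τ i := by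
    intro i
    have hmem : block σ i ∈ blockSet τ := h ▸ Finset.mem_image_of_mem _ (mem_univ i)
    obtain ⟨x, -, hx⟩ := Finset.mem_image.1 hmem
    have hi : i ∈ block τ x := hx ▸ mem_block.2 (σ.refl i)
    rw [← hx]
    exact (block_eq_block_iff τ x i).2 (mem_block.1 hi)
  refine Setoid.ext fun i j => ?_
  rw [← block_eq_block_iff σ, ← block_eq_block_iff τ, key, key]

end Blocks

end PercRepro
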